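import Literature.NumberTheory.EllipticCurves.GaloisAction
import Mathlib.AlgebraicGeometry.EllipticCurve.ModelsWithJ
import HarnessLib

/-!
# Surjectivity of the mod `2ⁿ` Galois representations of an elliptic curve over `ℚ`
# (Dokchitser–Dokchitser 2012; the mod-`8` ⟹ `2`-adic lift)

Topic `NumberTheory/EllipticCurves`. Two NAMED FACTS (published theorems, not proved here) and one
proved corollary, in the vocabulary of `GaloisAction.lean`
(`WeierstrassCurve.HasSurjectiveModNGaloisRep W n` = "`ρ̄_{E,n} : Γ_ℚ → Aut(E[n])` is onto";
for `E[n] ≅ (ℤ/n)²` this is "`ρ̄_{E,n}` onto `GL₂(ℤ/nℤ)`").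

* `DokchitserDokchitser2012_surjective_mod_two_four_eight` — T. Dokchitser, V. Dokchitser,
  *Surjectivity of mod `2ⁿ` representations of elliptic curves*, Math. Z. 272 (2012) 961–964,
  **Theorem** (p. 961): for `E : y² = x³ + ax + b` over `ℚ` with `Δ = −16(4a³ + 27b²)`,
  `j = −1728(4a)³/Δ`: (1) `ρ̄₂` onto ⟺ `x³ + ax + b` irreducible and `Δ ∉ ℚ^{×2}`; (2) `ρ̄₄` onto ⟺
  `ρ̄₂` onto, `Δ ∉ −1·ℚ^{×2}` and `j ≠ −4t³(t + 8)` for every `t ∈ ℚ`; (3) `ρ̄₈` onto ⟺ `ρ̄₄` onto and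
  `Δ ∉ ±2·ℚ^{×2}`. SPELLING: every `E/ℚ` has such a model and all quantities are isomorphism
  invariants (the image of `ρ̄ₙ` up to conjugacy; `Δ` up to `ℚ^{×12} ⊂ ℚ^{×2}`; `j`; and "the
  `2`-division cubic is irreducible" ⟺ "`E(ℚ)` has no point of order `2`", the cubic having degree
  `3`), so the fact is stated for an arbitrary Weierstrass model with "no rational point of exact
  order `2`" for "irreducible" and `¬ IsSquare (c·Δ)` for "`Δ ∉ c·ℚ^{×2}`" (`Δ ≠ 0`).
* `hasSurjectiveModNGaloisRep_two_pow_of_eight` — the lift "`ρ̄₈` onto ⟹ `ρ̄_{2ⁿ}` onto for all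
  `n`" (equivalently `ρ_{E,2^∞}` onto `GL₂(ℤ₂)`): the `2`-adic companion of Serre's `ℓ ≥ 5` lemma
  (tree: `serre_hasSurjectiveModNGaloisRep_pow`, and the PROVED finite-level group theory
  `GaloisRepresentations/SerreSL2Lifting.lean`). In print: Rouse–Zureick-Brown, *Elliptic curves over
  `ℚ` and `2`-adic images of Galois*, Res. Number Theory 1 (2015), §3, Lemma ("Suppose
  `Γ(2ᵏ) ⊆ H ⊆ GL₂(ℤ₂)` and `k ≥ 2`. If `K` is a maximal subgroup of `H`, then `Γ(2ᵏ⁺¹) ⊆ K`";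
  with `H = GL₂(ℤ₂)`, `k = 2`: every maximal closed subgroup contains `Γ(8)`, so a closed subgroup
  mapping onto `GL₂(ℤ/8ℤ)` is everything) and §1 ("whether the mod `8`, and thus the `2`-adic, image
  of Galois is surjective"); Dokchitser–Dokchitser, loc. cit., Introduction ("`ρ̄_{ℓⁿ}` surjective ⇏
  `ρ̄_{ℓⁿ⁺¹}` surjective for `ℓⁿ = 2, 3, 4`" — and only for those). The group theory at finite level
  (`H ≤ GL₂(ℤ/2ᴺ)`, `N ≥ 3`, `H ↠ GL₂(ℤ/8)` ⟹ `H = GL₂(ℤ/2ᴺ)`: if `H ↠ GL₂(ℤ/2ᵏ)`, `k ≥ 3`, and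
  `u = 1 + 2ᵏM`, pick `h ∈ H`, `h ≡ 1 + 2ᵏ⁻¹M (mod 2ᵏ)`; then `h² ≡ u (mod 2ᵏ⁺¹)` as `2k − 2 ≥ k + 1`)
  is elementary; what keeps the curve-level statement a fact is, as for Serre's lemma, the missing
  tree identification `E[2ᴺ] ≅ (ℤ/2ᴺ)²` with `det ρ̄ = χ_cyc` and the compatibility of the `ρ̄_{2ᴺ}`
  under `E[2ᴺ] → E[8]`.
* `hasSurjectiveModNGaloisRep_two_pow_of_criteria` (PROVED from the two facts) — the per-curve
  discharge shape: no rational `2`-torsion, `Δ, −Δ, 2Δ, −2Δ` non-squares, `j ∉ {−4t³(t+8)}` ⟹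
  `ρ̄_{2ⁿ}` onto for every `n` (the binder `TwoAdicSurjective W` of `Summits/…/X5/TwoAdicTargets.lean`).

What is NOT here: the `GL₂(ℤ₂)`-valued `2`-adic representation itself (the tree spells
"`ρ_{2^∞}` onto" as "every `ρ̄_{2ⁿ}` onto"); the finite-level group lemma as a theorem (a natural
companion to `SerreSL2Lifting.lean`, not needed by the consumers); any use of the facts.

## References

* T. Dokchitser, V. Dokchitser, *Surjectivity of mod `2ⁿ` representations of elliptic curves*,
  Math. Z. 272 (2012), 961–964, Theorem and Introduction. [DokchitserDokchitserMathZ2012]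
  [corpus:paper:arxiv-1104.5031 p0001]
* J. Rouse, D. Zureick-Brown, *Elliptic curves over `ℚ` and `2`-adic images of Galois*, Research in
  Number Theory 1 (2015), §1 and §3 (Lemma on maximal subgroups). [RouseZureickbrown2015]
  [corpus:paper:arxiv-1402.5997 p0003, p0008]
* J.-P. Serre, *Propriétés galoisiennes des points d'ordre fini des courbes elliptiques*, Invent.
  Math. 15 (1972), §4. [Serre1972]
-/

set_option autoImplicit false

open scoped Classical

namespace Literature.NumberTheory.EllipticCurves

/-- **Dokchitser–Dokchitser 2012, Theorem** (surjectivity of `ρ̄₂`, `ρ̄₄`, `ρ̄₈` for `E/ℚ`). For an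
elliptic curve `E/ℚ` (any Weierstrass model `W`; printed for `y² = x³ + ax + b`, all quantities
being isomorphism invariants — module docstring):
(1) `ρ̄_{E,2}` is onto ⟺ `E(ℚ)` has no point of exact order `2` (⟺ the `2`-division cubic is
irreducible over `ℚ`) and `Δ ∉ ℚ^{×2}`;
(2) `ρ̄_{E,4}` is onto ⟺ `ρ̄_{E,2}` is onto, `Δ ∉ −1·ℚ^{×2}` and `j(E) ≠ −4t³(t + 8)` for every `t ∈ ℚ`;
(3) `ρ̄_{E,8}` is onto ⟺ `ρ̄_{E,4}` is onto and `Δ ∉ ±2·ℚ^{×2}`.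
("`Δ ∉ c·ℚ^{×2}`", `c ∈ {1, −1, 2, −2}`, is spelled `¬ IsSquare (c * Δ)`: `Δ ∈ cℚ^{×2} ⟺ cΔ ∈ ℚ^{×2}`
as `c² ∣ c²` and `Δ ≠ 0`.) [cite: DokchitserDokchitserMathZ2012, Theorem (p. 961)] -/
def DokchitserDokchitser2012_surjective_mod_two_four_eight : Prop :=
  ∀ (W : WeierstrassCurve ℚ) [W.IsElliptic],
    (W.HasSurjectiveModNGaloisRep 2 ↔
      (∀ P : W.toAffine.Point, 2 • P = 0 → P = 0) ∧ ¬ IsSquare W.Δ) ∧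
    (W.HasSurjectiveModNGaloisRep 4 ↔
      W.HasSurjectiveModNGaloisRep 2 ∧ ¬ IsSquare (-W.Δ) ∧
        ∀ t : ℚ, W.j ≠ -4 * t ^ 3 * (t + 8)) ∧
    (W.HasSurjectiveModNGaloisRep 8 ↔
      W.HasSurjectiveModNGaloisRep 4 ∧ ¬ IsSquare (2 * W.Δ) ∧ ¬ IsSquare (-2 * W.Δ))

/-- **`ρ̄_{E,8}` onto ⟹ `ρ̄_{E,2ⁿ}` onto for every `n`** (`E/ℚ`; i.e. `ρ_{E,2^∞}` onto `GL₂(ℤ₂)`):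
every maximal closed subgroup of `GL₂(ℤ₂)` contains `Γ(8)` (Rouse–Zureick-Brown 2015, §3, Lemma:
`Γ(2ᵏ) ⊆ H`, `k ≥ 2`, `K < H` maximal ⟹ `Γ(2ᵏ⁺¹) ⊆ K`; take `H = GL₂(ℤ₂)`, `k = 2`), so a closed
subgroup mapping onto `GL₂(ℤ/8ℤ)` is `GL₂(ℤ₂)` ("the mod `8`, and thus the `2`-adic, image", §1);
the failure of the analogous lift at levels `2` and `4` is Dokchitser–Dokchitser's Introduction. The
`2`-adic companion of `serre_hasSurjectiveModNGaloisRep_pow` (`ℓ ≥ 5`); for `n = 0` the target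
`Aut(E[1])` is trivial. [cite: RouseZureickbrown2015, §3 Lemma (maximal subgroups ⊇ Γ(2^(k+1))) and §1]
[cite: DokchitserDokchitserMathZ2012, Introduction (p. 961)] -/
def hasSurjectiveModNGaloisRep_two_pow_of_eight : Prop :=
  ∀ (W : WeierstrassCurve ℚ) [W.IsElliptic],
    W.HasSurjectiveModNGaloisRep 8 → ∀ n : ℕ, W.HasSurjectiveModNGaloisRep ((2 : ℤ) ^ n)

/-- **Per-curve criterion for a surjective `2`-adic image (PROVED from the two facts):** if `E(ℚ)`
has no point of order `2`, none of `Δ, −Δ, 2Δ, −2Δ` is a rational square and `j(E) ≠ −4t³(t + 8)` for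
all `t ∈ ℚ`, then `ρ̄_{E,2ⁿ}` is onto for every `n` — the shape in which the habitat binder
`TwoAdicSurjective W := ∀ n, 0 < n → W.HasSurjectiveModNGaloisRep (2^n)` of the O1 routes is
discharged per curve. [cite: DokchitserDokchitserMathZ2012, Theorem (p. 961)]
[cite: RouseZureickbrown2015, §3 Lemma and §1] -/
theorem hasSurjectiveModNGaloisRep_two_pow_of_criteria
    (hDD : DokchitserDokchitser2012_surjective_mod_two_four_eight)
    (hlift : hasSurjectiveModNGaloisRep_two_pow_of_eight)
    (W : WeierstrassCurve ℚ) [W.IsElliptic]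
    (h2 : ∀ P : W.toAffine.Point, 2 • P = 0 → P = 0) (hΔ : ¬ IsSquare W.Δ)
    (hΔ₁ : ¬ IsSquare (-W.Δ)) (hΔ₂ : ¬ IsSquare (2 * W.Δ)) (hΔ₃ : ¬ IsSquare (-2 * W.Δ))
    (hj : ∀ t : ℚ, W.j ≠ -4 * t ^ 3 * (t + 8)) (n : ℕ) :
    W.HasSurjectiveModNGaloisRep ((2 : ℤ) ^ n) := by
  obtain ⟨h₂, h₄, h₈⟩ := hDD W
  have hs2 : W.HasSurjectiveModNGaloisRep 2 := h₂.mpr ⟨h2, hΔ⟩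
  have hs4 : W.HasSurjectiveModNGaloisRep 4 := h₄.mpr ⟨hs2, hΔ₁, hj⟩
  have hs8 : W.HasSurjectiveModNGaloisRep 8 := h₈.mpr ⟨hs4, hΔ₂, hΔ₃⟩
  exact hlift W hs8 n

end Literature.NumberTheory.EllipticCurves
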